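import Summits.QuantumAdvantage.AdviceFreeQNC0.AffBells23RingCond
import HarnessLib

/-!
# Sketch23 §3b (planner qn-p1 g23, ROUND-22 §1.3; ask P-23b): gap (G1) CLOSED — `juntaCommonHard2`, `ringHardOddCond2`

Verbatim copy of the second half of `HOME/qa-qnc0-p1/exp23/Sketch23.lean` §3b (authored by the planner seat qn-p1 g23,
landed by qn-prover-3 g12; only this header is new):

* `RingCond.ringCondOfSubcube : RingCondOfSubcube` — the fibrewise transport: partition the u-cube by the shadow bits
  `u|_S`, `S = uShadow W` (`|S| ≤ 2|W|`), on each part `x|_W` is constant, the transported strategy is polylog-degree in the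
  free bits (`hasDeg_comp_merge`), apply `WalkHardAllSubcube (max δ₀ 0 + 1/2)` per part and average over the `2^n` shadow
  values via the involution `mergeSwap` (`sum_card_filter_merge`);
* `RingCond.juntaCommonOfCond : JuntaCommonOfCond` — a `(T_k ∪ W)`-reader restricted to `{x_W = a}` is a `w₀`-junta of the
  free bits, an `𝔽₂`-polynomial of degree `≤ w₀ ≤ log₂ N`;
* hence, over the tree theorem `walkHardAllSubcube`: **`juntaCommonHard2 : JuntaCommonHard2`** (junta strategies reading in
  addition a COMMON set of `≤ δ₀N` inputs have value `≤ θ < 1`, every `δ₀ < 1/2`, one `θ` for all `w₀`) and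
  **`ringHardOddCond2 : δ₀ < 1/2 → RingHardOddCond2 δ₀`** — Sketch22's (G1) `JuntaHardConditioned` for all `δ₀ < 1/2`.

Separation NOT moved.
-/

noncomputable section

open Classical

namespace Summit.QuantumAdvantage.AdviceFreeQNC0

open Finset
open Literature.Computability.QuantumComplexity Literature.Computability.QuantumComplexity.RingHLF
open Literature.Computability.MetaComplexity Literature.Computability.MetaComplexity.Smolensky
open F4 TubePlanProof AffBells22

namespace AffBells23
namespace RingCond

/-- **`RingCondOfSubcube` PROVED** (the fibrewise transport): `θ = θ(WalkHardAllSubcube (max δ₀ 0 + 1/2))`,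
`n₀(C) = max (n₀^walk(2C+1) + 1, ⌈4δ⁺/(1−2δ⁺)⌉ + 1, 4³ + 1)`. -/
theorem ringCondOfSubcube : RingCondOfSubcube := by
  intro hWalk δ₀ hδ₀
  set δp : ℝ := max δ₀ 0 with hδp
  have hδp0 : 0 ≤ δp := le_max_right _ _
  have hδ₀p : δ₀ ≤ δp := le_max_left _ _
  have hδp1 : δp < 1 / 2 := max_lt hδ₀ (by norm_num)
  obtain ⟨θ, hθ, hC⟩ := hWalk (δp + 1 / 2) (by linarith)
  refine ⟨θ, hθ, fun C => ?_⟩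
  obtain ⟨n₀, hn₀⟩ := hC (2 * C + 1)
  obtain ⟨n₂, hn₂⟩ := exists_nat_ge (4 * δp / (1 - 2 * δp))
  refine ⟨max (n₀ + 1) (max (n₂ + 1) (4 ^ (2 + 1) + 1)), fun N hN W P hW hP => ?_⟩
  obtain ⟨n, rfl⟩ : ∃ n, N = n + 1 := ⟨N - 1, by omega⟩
  have hA := le_max_left (n₀ + 1) (max (n₂ + 1) (4 ^ (2 + 1) + 1))
  have hB := le_max_right (n₀ + 1) (max (n₂ + 1) (4 ^ (2 + 1) + 1))
  have hB1 := le_max_left (n₂ + 1) (4 ^ (2 + 1) + 1)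
  have hB2 := le_max_right (n₂ + 1) (4 ^ (2 + 1) + 1)
  have hn₀n : n₀ ≤ n := by omega
  have hn₂n : n₂ ≤ n := by omega
  have hn4 : 4 ^ (2 + 1) ≤ n := by omega
  have hn2 : 2 ≤ n := by omega
  simp only [Nat.add_sub_cancel]
  -- |S| ≤ (δ⁺ + 1/2)·n
  have hScard : ((uShadow W).card : ℝ) ≤ (δp + 1 / 2) * n := by
    have h1 : ((uShadow W).card : ℝ) ≤ 2 * W.card := by exact_mod_cast card_uShadow_le W
    have hW' : (W.card : ℝ) ≤ δ₀ * (n + 1) := by push_cast at hW; exact hW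
    have h2 : (W.card : ℝ) ≤ δp * (n + 1) := by
      have : (0 : ℝ) ≤ n + 1 := by positivity
      nlinarith
    have hpos : 0 < 1 - 2 * δp := by linarith
    have hn2r : (n₂ : ℝ) ≤ n := by exact_mod_cast hn₂n
    have h3 : 4 * δp ≤ n * (1 - 2 * δp) := (div_le_iff₀ hpos).mp (hn₂.trans hn2r)
    nlinarith
  -- the transported strategy (as in `walkTransportF`)
  set z : (Fin (n + 1) → Bool) → (Fin (n + 1) → Bool) := fun x i => decide (P i x = 1) with hz
  set y : Fin (n + 1) → (Fin n → Bool) → Bool :=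
    fun g u => xor (z (xOfU u) g) (tGuess (xOfU u) g) with hy
  -- on each part `{u|_S = b|_S}` it is a polylog-degree polynomial of the free bits
  have hdeg : ∀ (b : Fin n → Bool) (g : Fin (n + 1)),
      HasDeg (fun u => y g (subcubeMerge (uShadow W) b u)) ((Nat.log 2 n) ^ (2 * C + 1)) := by
    intro b g
    have ht := hasDegF_transport (p := 2) (fun x => P g (subcubeMerge W (aOf W b) x)) (hP (aOf W b) g) g
    have ht' : HasDeg (fun u : Fin n → Bool =>
        xor (decide (P g (subcubeMerge W (aOf W b) (xOfU u)) = 1)) (tGuess (xOfU u) g)) ((Nat.log 2 n) ^ (2 * C + 1)) := by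
      unfold HasDegF at ht
      unfold HasDeg
      exact lowDeg_mono (degBook (p := 2) le_rfl hn4 C) ht
    have hm := hasDeg_comp_merge (uShadow W) b ht'
    have hfun : (fun u => y g (subcubeMerge (uShadow W) b u))
        = fun u => xor (decide (P g (subcubeMerge W (aOf W b) (xOfU (subcubeMerge (uShadow W) b u))) = 1))
            (tGuess (xOfU (subcubeMerge (uShadow W) b u)) g) := by
      funext u
      simp only [hy, hz]
      rw [merge_aOf_xOfU]
    rw [hfun]
    exact hm
  -- every part loses (the tree theorem `walkHardAllSubcube`, through the hypothesis)
  have hwin : ∀ b : Fin n → Bool,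
      ((univ.filter fun u : Fin n → Bool => ringWinU (n + 2) y (subcubeMerge (uShadow W) b u) = true).card : ℝ)
        ≤ θ * (2 : ℝ) ^ n :=
    fun b => hn₀ n hn₀n (n + 2) (uShadow W) b hScard y (hdeg b)
  -- averaging over the parts
  have hwinall : ((univ.filter fun v : Fin n → Bool => ringWinU (n + 2) y v = true).card : ℝ) ≤ θ * (2 : ℝ) ^ n := by
    have hnat := sum_card_filter_merge (uShadow W) (fun v : Fin n → Bool => ringWinU (n + 2) y v = true)
    have hcast : (2 : ℝ) ^ n * ((univ.filter fun v : Fin n → Bool => ringWinU (n + 2) y v = true).card : ℝ)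
        = ∑ b : Fin n → Bool,
            ((univ.filter fun u : Fin n → Bool => ringWinU (n + 2) y (subcubeMerge (uShadow W) b u) = true).card : ℝ) := by
      exact_mod_cast hnat.symm
    have hsum : (2 : ℝ) ^ n * ((univ.filter fun v : Fin n → Bool => ringWinU (n + 2) y v = true).card : ℝ)
        ≤ (2 : ℝ) ^ n * (θ * (2 : ℝ) ^ n) := by
      rw [hcast]
      calc ∑ b : Fin n → Bool,
            ((univ.filter fun u : Fin n → Bool => ringWinU (n + 2) y (subcubeMerge (uShadow W) b u) = true).card : ℝ)
          ≤ ∑ _b : Fin n → Bool, θ * (2 : ℝ) ^ n := Finset.sum_le_sum fun b _ => hwin b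
        _ = (2 : ℝ) ^ n * (θ * (2 : ℝ) ^ n) := by
          rw [Finset.sum_const, Finset.card_univ, nsmul_eq_mul, Fintype.card_fun, Fintype.card_bool, Fintype.card_fin]
          push_cast
          ring
    exact le_of_mul_le_mul_left hsum (by positivity)
  -- inject the odd class into the walk game's winning inputs (as in `walkTransportF`)
  have hodd : (univ.filter fun x : Fin (n + 1) → Bool => OddZeros x ∧ Rel x (z x)).card ≤
      (univ.filter fun u : Fin n → Bool => ringWinU (n + 2) y u = true).card := by
    refine Finset.card_le_card_of_injOn uVec ?_ ?_
    · intro x hx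
      rw [Finset.mem_coe, mem_filter] at hx
      rw [Finset.mem_coe, mem_filter]
      exact ⟨mem_univ _, (rel_iff_ringWinU (by omega) x hx.2.1 z).1 hx.2.2⟩
    · intro x₁ hx₁ x₂ hx₂ h
      rw [Finset.mem_coe, mem_filter] at hx₁ hx₂
      rw [← xOfU_uVec (by omega) x₁ hx₁.2.1, ← xOfU_uVec (by omega) x₂ hx₂.2.1, h]
  exact le_trans (by exact_mod_cast hodd) hwinall

/-- **`JuntaCommonOfCond` PROVED**: a `(T_k ∪ W)`-reader on `{x_W = a}` is a `T_k`-junta, of `𝔽₂`-degree `≤ |T_k| ≤ log₂ N`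
(`indicator_mem_lowDeg`); `θ = θ(RingHardOddCond2 δ₀)` at degree exponent `1`, `n₀(w₀) = max (n₀(1), 2^{w₀})`. -/
theorem juntaCommonOfCond : JuntaCommonOfCond := by
  intro hCond δ₀ hδ₀
  obtain ⟨θ, hθ, hall⟩ := hCond δ₀ hδ₀
  refine ⟨θ, hθ, fun w₀ => ?_⟩
  obtain ⟨n₀, hn₀⟩ := hall 1
  refine ⟨max n₀ (2 ^ w₀), fun N hN W T g hW hT hread => ?_⟩
  have hNn₀ : n₀ ≤ N := le_trans (le_max_left _ _) hN
  have hlog : w₀ ≤ Nat.log 2 N := Nat.le_log_of_pow_le (by norm_num) (le_trans (le_max_right _ _) hN)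
  set P : Fin N → CubeFn (ZMod 2) N := fun k x => if g k x then 1 else 0 with hP
  have hdeg : ∀ (a : Fin N → Bool) (k : Fin N),
      (fun x => P k (subcubeMerge W a x)) ∈ lowDeg (ZMod 2) N ((Nat.log 2 N) ^ 1) := by
    intro a k
    rw [pow_one]
    have hjunta : ReadsOnly (T k) (fun x => g k (subcubeMerge W a x)) := by
      intro x x' hxx'
      apply hread k
      intro i hi
      rw [mem_union] at hi
      unfold subcubeMerge
      by_cases hiW : i ∈ W
      · rw [if_pos hiW, if_pos hiW]
      · rw [if_neg hiW, if_neg hiW]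
        rcases hi with h | h
        · exact hxx' i h
        · exact absurd h hiW
    exact lowDeg_mono (le_trans (hT k) hlog) (indicator_mem_lowDeg (T k) _ hjunta)
  have h := hn₀ N hNn₀ W P hW hdeg
  have hfun : ∀ x : Fin N → Bool, (fun i => decide (P i x = 1)) = fun k => g k x := by
    intro x
    funext k
    simp only [hP]
    by_cases hgk : g k x = true
    · simp [hgk]
    · simp [hgk]
  have hset : ((univ : Finset (Fin N → Bool)).filter fun x => OddZeros x ∧ Rel x (fun k => g k x))
      = (univ : Finset (Fin N → Bool)).filter fun x => OddZeros x ∧ Rel x (fun i => decide (P i x = 1)) := by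
    ext x
    simp only [mem_filter, hfun x]
  unfold winCount
  rw [hset]
  exact h

end RingCond

/-- **(G1) CLOSED — `JuntaCommonHard2` UNCONDITIONALLY**: `w₀`-junta strategies reading in addition a COMMON set of `≤ δ₀N` inputs,
`δ₀ < 1/2`, lose a constant fraction of the odd class (`θ = θ(walkHardF_two)`).  Chain: `failSet_ge_of_mem_fullSpan` →
`walkHardAllSubcube` (tree) → `ringCondOfSubcube` → `juntaCommonOfCond` (here). -/
theorem juntaCommonHard2 : JuntaCommonHard2 := g1Chain RingCond.ringCondOfSubcube RingCond.juntaCommonOfCond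

/-- **`RingHardOddCond2 δ₀` for every `δ₀ < 1/2`, UNCONDITIONALLY**: polylog-degree `𝔽₂`-strategies with ARBITRARY dependence on a common set of
`≤ δ₀N` inputs lose a constant fraction of the odd class (`= RingHardOdd 2` conditioned on `x_W`; P-22h answered in the kernel). -/
theorem ringHardOddCond2 {δ₀ : ℝ} (h : δ₀ < 1 / 2) : RingHardOddCond2 δ₀ := RingCond.ringCondOfSubcube ringCondOfSubcube_hyp δ₀ h

end AffBells23

end Summit.QuantumAdvantage.AdviceFreeQNC0
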